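import Mathlib
import Literature.Combinatorics.Additive.TripleProductProperty
import Summits.MatrixMultiplication.MatrixMultiplication.Theorems.HyperoctahedralThreshold.Negative.PermData

/-!
# Witness: `P_hyp(8) ≥ 221184` (certified census, `n = 8`)

An explicit TPP triple of volume `24·24·384 = 221184` inside the centralisers of three
fixed-point-free involutions of `Fin 8` — the matrix of `¬ HyperoctahedralSubsets` / `HyperoctahedralThreshold` at
`n = 8` with `221184` in place of the threshold; `(8!)^(3/2) ≈ 8 096 192`, ratio `0.0273` (`0.272` at `n = 4`,
`0.106` at `n = 6`; certified upper bound at `n = 8`: `2 502 411`, `Census8Bound.hyp8_volume_le`).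
Source: two subgroups of order 24 of `C(W8mu 0)`, `C(W8mu 1)` and the whole centraliser `C(W8mu 2)` (host class with matching unions of cycle types (4,4), (8), (8)); found by the seat's exhaustive search over TPP triples of subgroups of the three hosts (all 1659 subgroups of `S_2 ≀ S_4` per host, kit job j020166; 16 such pairs in this class) — the maximum volume over subgroup triples in every host class searched.
Permutations are written with `pdN 8 "<images>"` (`PermData`); the TPP is checked by evaluation through
`tpp_of_closed_sub_host` (two quotient-closed sets and a whole centraliser).
-/

namespace Summit.MatrixMultiplication.MatrixMultiplication.Theorems.HyperoctahedralThreshold.Negative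

set_option linter.dupNamespace false

open Literature.Combinatorics.Additive

/-- **TPP with the third set inside a centraliser.**  If `S` and `T` are closed under `a b⁻¹`, every
element of `U` commutes with `μ`, and the only `(s, t) ∈ S × T` for which `s t` commutes with `μ` is
`(1, 1)`, then `(S, T, U)` has the triple product property: the quotient `u u'⁻¹` of two elements of `U`
commutes with `μ`, hence so does its inverse `(s s'⁻¹)(t t'⁻¹) ∈ S T`.  (All sets stay metavariables in
the conclusion, so a witness instantiates it by unification alone and every hypothesis is evaluated.)
[cite: CohnUmans2003, Def. 2.1] -/
theorem tpp_of_closed_sub_host {G : Type*} [Group G] (μ : G) {S T U : Finset G}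
    (hS : ∀ a ∈ S, ∀ b ∈ S, a * b⁻¹ ∈ S) (hT : ∀ a ∈ T, ∀ b ∈ T, a * b⁻¹ ∈ T)
    (hU : ∀ u ∈ U, u * μ = μ * u)
    (h : ∀ s ∈ S, ∀ t ∈ T, s * t * μ = μ * (s * t) → s = 1 ∧ t = 1) :
    TripleProductProperty S T U := by
  intro s hs s' hs' t ht t' ht' u hu u' hu' heq
  have hu1 := hU u hu
  have hu2 := hU u' hu'
  have hq : u * u'⁻¹ * μ = μ * (u * u'⁻¹) := by
    have hu'' : u'⁻¹ * μ = μ * u'⁻¹ := by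
      calc u'⁻¹ * μ = u'⁻¹ * (μ * u') * u'⁻¹ := by group
        _ = u'⁻¹ * (u' * μ) * u'⁻¹ := by rw [hu2]
        _ = μ * u'⁻¹ := by group
    calc u * u'⁻¹ * μ = u * (u'⁻¹ * μ) := by group
      _ = u * (μ * u'⁻¹) := by rw [hu'']
      _ = (u * μ) * u'⁻¹ := by group
      _ = (μ * u) * u'⁻¹ := by rw [hu1]
      _ = μ * (u * u'⁻¹) := by group
  have hw : s * s'⁻¹ * (t * t'⁻¹) = (u * u'⁻¹)⁻¹ := eq_inv_of_mul_eq_one_left heq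
  have hcomm : s * s'⁻¹ * (t * t'⁻¹) * μ = μ * (s * s'⁻¹ * (t * t'⁻¹)) := by
    rw [hw]
    calc (u * u'⁻¹)⁻¹ * μ = (u * u'⁻¹)⁻¹ * (μ * (u * u'⁻¹)) * (u * u'⁻¹)⁻¹ := by group
      _ = (u * u'⁻¹)⁻¹ * ((u * u'⁻¹) * μ) * (u * u'⁻¹)⁻¹ := by rw [hq]
      _ = μ * (u * u'⁻¹)⁻¹ := by group
  obtain ⟨e0, e1⟩ := h _ (hS s hs s' hs') _ (hT t ht t' ht') hcomm
  have e2 : u * u'⁻¹ = 1 := by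
    have := hw.symm
    rw [e0, e1, mul_one, inv_eq_one] at this
    exact this
  exact ⟨mul_inv_eq_one.1 e0, mul_inv_eq_one.1 e1, mul_inv_eq_one.1 e2⟩

/-! ### List-level Boolean checks (explicit iteration; avoids the `Fintype`-quantifier decision path,
which would enumerate all `40320` permutations at every quantifier level) -/

/-- `l` is closed under `a b⁻¹` (Boolean, by explicit iteration over the list). [folklore] -/
def closedL {G : Type*} [Group G] [DecidableEq G] (l : List G) : Bool :=
  l.all fun a => l.all fun b => l.any fun c => decide (c = a * b⁻¹)

/-- Soundness of `closedL`. [folklore] -/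
theorem closed_of_closedL {G : Type*} [Group G] [DecidableEq G] {l : List G} (h : closedL l = true) :
    ∀ a ∈ l.toFinset, ∀ b ∈ l.toFinset, a * b⁻¹ ∈ l.toFinset := by
  intro a ha b hb
  simp only [closedL, List.all_eq_true, List.any_eq_true, decide_eq_true_eq] at h
  rw [List.mem_toFinset] at ha hb ⊢
  obtain ⟨c, hc, rfl⟩ := h a ha b hb
  exact hc

/-- The only `(s, t) ∈ l × m` with `s t` commuting with `μ` is `(1, 1)` (Boolean, explicit iteration).
[folklore] -/
def pairL {G : Type*} [Group G] [DecidableEq G] (μ : G) (l m : List G) : Bool :=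
  l.all fun s => m.all fun t => (!decide (s * t * μ = μ * (s * t))) || (decide (s = 1) && decide (t = 1))

/-- Soundness of `pairL`. [folklore] -/
theorem pair_of_pairL {G : Type*} [Group G] [DecidableEq G] {μ : G} {l m : List G}
    (h : pairL μ l m = true) :
    ∀ s ∈ l.toFinset, ∀ t ∈ m.toFinset, s * t * μ = μ * (s * t) → s = 1 ∧ t = 1 := by
  intro s hs t ht hc
  simp only [pairL, List.all_eq_true, Bool.or_eq_true, Bool.not_eq_true', decide_eq_false_iff_not,
    Bool.and_eq_true, decide_eq_true_eq] at h
  rw [List.mem_toFinset] at hs ht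
  rcases h s hs t ht with hn | hy
  · exact absurd hc hn
  · exact hy

/-- Every element of `l` commutes with `μ` (Boolean, explicit iteration). [folklore] -/
def hostedL {G : Type*} [Group G] [DecidableEq G] (μ : G) (l : List G) : Bool :=
  l.all fun a => decide (a * μ = μ * a)

/-- Soundness of `hostedL`. [folklore] -/
theorem hosted_of_hostedL {G : Type*} [Group G] [DecidableEq G] {μ : G} {l : List G}
    (h : hostedL μ l = true) : ∀ a ∈ l.toFinset, a * μ = μ * a := by
  intro a ha
  simp only [hostedL, List.all_eq_true, decide_eq_true_eq] at h
  exact h a (List.mem_toFinset.1 ha)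

/-- The host triple of the witness (three fixed-point-free involutions of `Fin 8`). -/
def W8mu : Fin 3 → Equiv.Perm (Fin 8) := ![pdN 8 "10325476", pdN 8 "23016745", pdN 8 "46750312"]

/-- First set of the witness (`24` elements of `C(W8mu 0)`). -/
def W8X0 : List (Equiv.Perm (Fin 8)) :=
  [pdN 8 "01234567", pdN 8 "01234576", pdN 8 "01235467", pdN 8 "01235476", pdN 8 "10234567", pdN 8 "10234576", pdN 8 "10235467", pdN 8 "10235476", pdN 8 "45236701", pdN 8 "45236710", pdN 8 "45237601", pdN 8 "45237610", pdN 8 "54236701", pdN 8 "54236710", pdN 8 "54237601", pdN 8 "54237610", pdN 8 "67230145", pdN 8 "67230154", pdN 8 "67231045", pdN 8 "67231054", pdN 8 "76230145", pdN 8 "76230154", pdN 8 "76231045", pdN 8 "76231054"]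

/-- Second set of the witness (`24` elements of `C(W8mu 1)`). -/
def W8X1 : List (Equiv.Perm (Fin 8)) :=
  [pdN 8 "01234567", pdN 8 "01234765", pdN 8 "03214567", pdN 8 "03214765", pdN 8 "15374062", pdN 8 "15374260", pdN 8 "17354062", pdN 8 "17354260", pdN 8 "21034567", pdN 8 "21034765", pdN 8 "23014567", pdN 8 "23014765", pdN 8 "35174062", pdN 8 "35174260", pdN 8 "37154062", pdN 8 "37154260", pdN 8 "50724163", pdN 8 "50724361", pdN 8 "52704163", pdN 8 "52704361", pdN 8 "70524163", pdN 8 "70524361", pdN 8 "72504163", pdN 8 "72504361"]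

/-- The three sets of the witness: `W8X0`, `W8X1` and the whole centraliser `C(W8mu 2)`. -/
def W8X : Fin 3 → Finset (Equiv.Perm (Fin 8)) :=
  ![W8X0.toFinset, W8X1.toFinset, Finset.univ.filter fun σ : Equiv.Perm (Fin 8) => σ * W8mu 2 = W8mu 2 * σ]

/-- Component `0` of `W8X`. -/
theorem W8X_zero : W8X 0 = W8X0.toFinset := rfl

/-- Component `1` of `W8X`. -/
theorem W8X_one : W8X 1 = W8X1.toFinset := rfl

/-- Component `2` of `W8X` is the whole centraliser, so its elements commute with `W8mu 2`. [folklore] -/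
theorem W8X_two_hosted : ∀ u ∈ W8X 2, u * W8mu 2 = W8mu 2 * u := by
  intro u hu
  have hu' : u ∈ (Finset.univ.filter fun σ : Equiv.Perm (Fin 8) => σ * W8mu 2 = W8mu 2 * σ) := hu
  exact (Finset.mem_filter.1 hu').2

/-- The hosts are fixed-point-free involutions (by evaluation). [folklore] -/
theorem W8mu_fpf : ∀ i, W8mu i * W8mu i = 1 ∧ ∀ x, W8mu i x ≠ x := by native_decide

/-- The sets are hosted: `W8X i ⊆ C(W8mu i)` (by evaluation). [folklore] -/
theorem W8X_hosted : ∀ i, ∀ σ ∈ W8X i, σ * W8mu i = W8mu i * σ := by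
  intro i
  fin_cases i
  · exact hosted_of_hostedL (μ := W8mu 0) (l := W8X0) (by native_decide)
  · exact hosted_of_hostedL (μ := W8mu 1) (l := W8X1) (by native_decide)
  · exact W8X_two_hosted

/-- The volume of the witness is `221184` (by evaluation). [folklore] -/
theorem W8X_card : (W8X 0).card * (W8X 1).card * (W8X 2).card = 221184 := by native_decide

/-- The witness has the triple product property (by evaluation, through
`tpp_of_closed_sub_host`). [cite: CohnUmans2003, Def. 2.1] -/
theorem W8X_tpp : TripleProductProperty (W8X 0) (W8X 1) (W8X 2) :=
  by
  rw [W8X_zero, W8X_one]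
  exact tpp_of_closed_sub_host (W8mu 2) (closed_of_closedL (by native_decide)) (closed_of_closedL (by native_decide))
    W8X_two_hosted (pair_of_pairL (by native_decide))

/-- **Witness for `P_hyp(8) ≥ 221184 = 24·24·384`**: an explicit TPP triple inside the centralisers of three
fixed-point-free involutions of `Fin 8` (the third set is the WHOLE centraliser, order `384`). [folklore] -/
theorem hyp8_witness :
    ∃ μ : Fin 3 → Equiv.Perm (Fin 8), (∀ i, μ i * μ i = 1 ∧ ∀ x, μ i x ≠ x) ∧
      ∃ X : Fin 3 → Finset (Equiv.Perm (Fin 8)), (∀ i, ∀ σ ∈ X i, σ * μ i = μ i * σ) ∧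
        TripleProductProperty (X 0) (X 1) (X 2) ∧ (X 0).card * (X 1).card * (X 2).card = 221184 := by
  exact ⟨W8mu, W8mu_fpf, W8X, W8X_hosted, W8X_tpp, W8X_card⟩

end Summit.MatrixMultiplication.MatrixMultiplication.Theorems.HyperoctahedralThreshold.Negative
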